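import Summits.CriticalPhenomena.PercolationContinuityZ3.Theorems.PercNearOneGluingNoHeavyLowerTailKnQuestion8CoefficientwiseCoreClassKernelMixBundleWords
import HarnessLib

/-!
# Boundary inequality on bundles, IV: the cluster-trace transfer of a prefix-frozen landing, and the chain lemma

Support file (`--supports stmt-CriticalPhenomena-4575`, closed), prover `prim-cplus-coupling` (gen 46).  No definitions, no notations, no named facts,
no sorries; standard axioms.  Memo `prim-cplus-coupling/A5-COUPLING-gen45.md` §3.9 (THEOREM BI), steps (a) (trace part) and (b).

Explicit bundle as in `…KernelMixBundleTraces` / `…KernelMixBundleWords` (threads `t < r`, vertices `w t j`, edges `e t j`, edge sets `A t`, `E = ⋃ A t`),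
two distinguished threads `p ≠ q` and at least one further thread `t₀`; `O = E ∖ (A p ∪ A q)` (the other threads), `C ω = C_u(ω)`.
* `Coefficientwise.bundle_boundary_transfer` — let `ξ ⊆ A p ∪ A q` be a point of the `(a, c)`-prefix-frozen fibre and `ρ ⊆ A p ∪ A q` its partner
  (first `a` edges of `p` red in both, edge `a+1` blue in both when `a ≥ 1`, all other edges of `p` complementary; likewise `c` on `q`), with no full
  thread in `ρ`.  Then the LIFT `λ = ξ ∪ O` (other threads red) is a supply point (`b ∈ C λ`, `b ∉ C(E∖λ)`) and the two cross traces transfer: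
  `C(E ∖ ρ) ⊆ C λ` (the k-level of the partner's blue cluster is inherited by the red cluster of the lift — the frozen blue edge `a+1` is covered from `u`
  through the red prefix) and `C(E ∖ λ) ⊆ C ρ`.  Memo §3.9 (a).
* `Coefficientwise.bundle_boundary_chain` — if two colourings without a full thread start blue (or are empty) on every thread except possibly one
  common thread `o`, their red clusters are `⊆`-comparable (both are `{u} ∪` a leading red run of `o`).  Memo §3.9 (b) (lemma (i)).
[cite: KozmaNitzan2024, Questions 8–9 (§5.5 p. 36) (context)]
-/

namespace Summit.CriticalPhenomena.PercolationContinuityZ3.Theorems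

open Finset Literature.Probability.Percolation

namespace Coefficientwise

variable {ι V : Type*}

open Classical in
/-- **Transfer of a prefix-frozen landing to its lift (cluster traces).**  See the module docstring: for a fibre point `ξ` and its partner `ρ` (edge-by-edge
hypotheses on the threads `p`, `q`; no full thread in `ρ`) and the lift `λ = ξ ∪ (E ∖ (A p ∪ A q))`: `b ∈ C λ`, `b ∉ C(E ∖ λ)`, `C(E ∖ ρ) ⊆ C λ` and
`C(E ∖ λ) ⊆ C ρ`.  Memo gen 45 §3.9 (a).  [cite: KozmaNitzan2024, Questions 8–9 (§5.5 p. 36) (context)] -/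
theorem bundle_boundary_transfer (ends : ι → Sym2 V) (r : ℕ) (L : ℕ → ℕ) (hL : ∀ t, t < r → 1 ≤ L t)
    (w : ℕ → ℕ → V) (e : ℕ → ℕ → ι) (u b : V)
    (hw0 : ∀ t, t < r → w t 0 = u) (hwL : ∀ t, t < r → w t (L t) = b)
    (harc : ∀ t, t < r → ∀ j, 1 ≤ j → j ≤ L t → ends (e t j) = s(w t (j - 1), w t j))
    (hwinj : ∀ t, t < r → ∀ i j, i ≤ L t → j ≤ L t → w t i = w t j → i = j)
    (hcross : ∀ t t', t < r → t' < r → t ≠ t' → ∀ i j, i ≤ L t → j ≤ L t' → w t i = w t' j → (i = 0 ∧ j = 0) ∨ (i = L t ∧ j = L t'))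
    (A : ℕ → Finset ι) (hA : ∀ t, t < r → ∀ i, i ∈ A t ↔ ∃ j, 1 ≤ j ∧ j ≤ L t ∧ e t j = i)
    (hAdisj : ∀ t t', t < r → t' < r → t ≠ t' → Disjoint (A t) (A t'))
    (E : Finset ι) (hEA : ∀ i, i ∈ E ↔ ∃ t, t < r ∧ i ∈ A t)
    (p q : ℕ) (hp : p < r) (hq : q < r) (hpq : p ≠ q) (t₀ : ℕ) (ht₀ : t₀ < r) (ht₀p : t₀ ≠ p) (ht₀q : t₀ ≠ q)
    (a c : ℕ) (haL : a < L p) (hcL : c < L q) (ξ ρ : Finset ι) (hξ : ξ ⊆ A p ∪ A q) (hρ : ρ ⊆ A p ∪ A q)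
    (hPa : ∀ j, 1 ≤ j → j ≤ a → e p j ∈ ξ ∧ e p j ∈ ρ) (hPa1 : 1 ≤ a → e p (a + 1) ∉ ξ ∧ e p (a + 1) ∉ ρ)
    (hPfree : ∀ j, 1 ≤ j → j ≤ L p → (a = 0 ∨ a + 2 ≤ j) → (e p j ∈ ρ ↔ e p j ∉ ξ))
    (hQc : ∀ j, 1 ≤ j → j ≤ c → e q j ∈ ξ ∧ e q j ∈ ρ) (hQc1 : 1 ≤ c → e q (c + 1) ∉ ξ ∧ e q (c + 1) ∉ ρ)
    (hQfree : ∀ j, 1 ≤ j → j ≤ L q → (c = 0 ∨ c + 2 ≤ j) → (e q j ∈ ρ ↔ e q j ∉ ξ))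
    (hNP : ¬ A p ⊆ ρ) (hNQ : ¬ A q ⊆ ρ) :
    b ∈ openCluster (ends '' (↑(ξ ∪ E \ (A p ∪ A q)) : Set ι)) u ∧
    b ∉ openCluster (ends '' (↑(E \ (ξ ∪ E \ (A p ∪ A q))) : Set ι)) u ∧
    openCluster (ends '' (↑(E \ ρ) : Set ι)) u ⊆ openCluster (ends '' (↑(ξ ∪ E \ (A p ∪ A q)) : Set ι)) u ∧
    openCluster (ends '' (↑(E \ (ξ ∪ E \ (A p ∪ A q))) : Set ι)) u ⊆ openCluster (ends '' (↑ρ : Set ι)) u := by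
  set C : Finset ι → Set V := fun ω => openCluster (ends '' (↑ω : Set ι)) u with hC
  set O : Finset ι := E \ (A p ∪ A q) with hO
  set lam : Finset ι := ξ ∪ O with hlam
  -- ## bundle bookkeeping
  have hr : 0 < r := lt_of_le_of_lt (Nat.zero_le p) hp
  have hAE : ∀ t, t < r → A t ⊆ E := fun t ht i hi => (hEA i).mpr ⟨t, ht, hi⟩
  have heA : ∀ t, t < r → ∀ j, 1 ≤ j → j ≤ L t → e t j ∈ A t := fun t ht j hj1 hjL => (hA t ht _).mpr ⟨j, hj1, hjL, rfl⟩
  have hE : ∀ i, i ∈ E → ∃ t, t < r ∧ ∃ j, 1 ≤ j ∧ j ≤ L t ∧ e t j = i := by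
    intro i hi
    obtain ⟨t, ht, hit⟩ := (hEA i).mp hi
    exact ⟨t, ht, (hA t ht i).mp hit⟩
  have full_iff : ∀ ω : Finset ι, ω ⊆ E → (b ∈ C ω ↔ ∃ t, t < r ∧ A t ⊆ ω) := fun ω hω =>
    bundle_b_mem_cluster_iff_threads ends r L hL w e u b hr hw0 hwL harc hwinj hcross A hA E hEA ω hω
  have hAO : ∀ t, t < r → t ≠ p → t ≠ q → A t ⊆ O := by
    intro t htr htp htq i hi
    rw [hO, Finset.mem_sdiff, Finset.mem_union]
    refine ⟨hAE t htr hi, ?_⟩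
    rintro (h1 | h1)
    · exact Finset.disjoint_left.mp (hAdisj t p htr hp htp) hi h1
    · exact Finset.disjoint_left.mp (hAdisj t q htr hq htq) hi h1
  have hOE : O ⊆ E := Finset.sdiff_subset
  have hPQE : A p ∪ A q ⊆ E := Finset.union_subset (hAE p hp) (hAE q hq)
  have hlamE : lam ⊆ E := Finset.union_subset (hξ.trans hPQE) hOE
  have hOlam : O ⊆ lam := Finset.subset_union_right
  have hξlam : ξ ⊆ lam := Finset.subset_union_left
  -- other threads are red in the lift and blue in `ξ`, `ρ`
  have other_red : ∀ t, t < r → t ≠ p → t ≠ q → ∀ j, 1 ≤ j → j ≤ L t → e t j ∈ lam :=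
    fun t ht htp htq j hj1 hjL => hOlam (hAO t ht htp htq (heA t ht j hj1 hjL))
  have other_notPQ : ∀ t, t < r → t ≠ p → t ≠ q → ∀ j, 1 ≤ j → j ≤ L t → e t j ∉ A p ∪ A q := by
    intro t ht htp htq j hj1 hjL hm
    have := hAO t ht htp htq (heA t ht j hj1 hjL)
    rw [hO, Finset.mem_sdiff] at this
    exact this.2 hm
  -- some edge of `p` (resp. `q`) is red in `ξ`
  have red_edge : ∀ (t n : ℕ), t < r → n < L t →
      (∀ j, 1 ≤ j → j ≤ n → e t j ∈ ξ ∧ e t j ∈ ρ) →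
      (∀ j, 1 ≤ j → j ≤ L t → (n = 0 ∨ n + 2 ≤ j) → (e t j ∈ ρ ↔ e t j ∉ ξ)) → ¬ A t ⊆ ρ →
      ∃ j, 1 ≤ j ∧ j ≤ L t ∧ e t j ∈ ξ := by
    intro t n ht hn hpre hfree hN
    by_cases hn0 : n = 0
    · obtain ⟨x, hx, hxρ⟩ := Finset.not_subset.mp hN
      obtain ⟨j, hj1, hjL, rfl⟩ := (hA t ht x).mp hx
      refine ⟨j, hj1, hjL, ?_⟩
      by_contra hjξ
      exact hxρ ((hfree j hj1 hjL (Or.inl hn0)).mpr hjξ)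
    · exact ⟨1, le_refl 1, hL t ht, (hpre 1 (le_refl 1) (by omega)).1⟩
  obtain ⟨jp, hjp1, hjpL, hjpξ⟩ := red_edge p a hp haL hPa hPfree hNP
  obtain ⟨jq, hjq1, hjqL, hjqξ⟩ := red_edge q c hq hcL hQc hQfree hNQ
  -- ## (F1), (F2): the lift is a supply point
  have hbX : b ∈ C lam := by
    rw [full_iff lam hlamE]
    exact ⟨t₀, ht₀, (hAO t₀ ht₀ ht₀p ht₀q).trans hOlam⟩
  have no_full_compl : ∀ t, t < r → ∃ j, 1 ≤ j ∧ j ≤ L t ∧ e t j ∉ E \ lam := by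
    intro t ht
    by_cases htp : t = p
    · subst htp; exact ⟨jp, hjp1, hjpL, fun hm => (Finset.mem_sdiff.mp hm).2 (hξlam hjpξ)⟩
    by_cases htq : t = q
    · subst htq; exact ⟨jq, hjq1, hjqL, fun hm => (Finset.mem_sdiff.mp hm).2 (hξlam hjqξ)⟩
    exact ⟨1, le_refl 1, hL t ht, fun hm => (Finset.mem_sdiff.mp hm).2 (other_red t ht htp htq 1 (le_refl 1) (hL t ht))⟩
  have hbY : b ∉ C (E \ lam) := by
    rw [full_iff (E \ lam) Finset.sdiff_subset]
    rintro ⟨t, ht, hsub⟩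
    obtain ⟨j, hj1, hjL, hn⟩ := no_full_compl t ht
    exact hn (hsub (heA t ht j hj1 hjL))
  -- ## (T2): the red cluster of the lift contains the blue cluster of the partner
  -- per-thread step for the two distinguished threads
  have step2 : ∀ (t n : ℕ), t < r → n < L t →
      (∀ j, 1 ≤ j → j ≤ n → e t j ∈ ξ ∧ e t j ∈ ρ) →
      (∀ j, 1 ≤ j → j ≤ L t → (n = 0 ∨ n + 2 ≤ j) → (e t j ∈ ρ ↔ e t j ∉ ξ)) →
      ∀ j, 1 ≤ j → j < L t →
      ((∀ j', 1 ≤ j' → j' ≤ j → e t j' ∈ E \ ρ) ∨ (∀ j', j < j' → j' ≤ L t → e t j' ∈ E \ ρ)) → w t j ∈ C lam := by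
    intro t n ht hn hpre hfree j hj1 hjL hruns
    have notρ_ξ : ∀ j', 1 ≤ j' → j' ≤ L t → (n = 0 ∨ n + 2 ≤ j') → e t j' ∈ E \ ρ → e t j' ∈ lam :=
      fun j' h1 h2 h3 hm => hξlam ((hfree j' h1 h2 h3).not_left.mp (Finset.mem_sdiff.mp hm).2)
    rcases hruns with hrun | hrun
    · -- a leading run blue in ρ: impossible if n ≥ 1 (edge 1 is red in ρ), a red run of ξ if n = 0
      by_cases hn0 : n = 0
      · exact bundle_prefix_mem_cluster ends r L w e u hw0 harc lam t ht j (le_of_lt hjL)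
          fun j' h1 h2 => notρ_ξ j' h1 (by omega) (Or.inl hn0) (hrun j' h1 h2)
      · exfalso
        exact (Finset.mem_sdiff.mp (hrun 1 (le_refl 1) hj1)).2 (hpre 1 (le_refl 1) (by omega)).2
    · -- a trailing run blue in ρ
      by_cases hjn : n + 1 ≤ j
      · -- beyond the frozen block: the run is red in ξ, hence in the lift, and b ∈ C lam
        exact bundle_suffix_mem_cluster ends r L w e u b hwL harc lam hbX t ht j (le_of_lt hjL)
          fun j' h1 h2 => notρ_ξ j' (by omega) h2 (by omega) (hrun j' h1 h2)
      · -- inside the red prefix: only j = n is possible, and w t n is reached from u through the prefix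
        have hjn' : j = n := by
          by_contra hne
          have hlt : j < n := by omega
          exact (Finset.mem_sdiff.mp (hrun n hlt (le_of_lt hn))).2 (hpre n (by omega) (le_refl n)).2
        subst hjn'
        exact bundle_prefix_mem_cluster ends r L w e u hw0 harc lam t ht j (le_of_lt hjL)
          fun j' h1 h2 => hξlam (hpre j' h1 h2).1
  have T2 : C (E \ ρ) ⊆ C lam := by
    intro v hv
    have h := bundle_cluster_subset_runs ends r L w e u b hw0 hwL harc hwinj hcross E hE (E \ ρ) Finset.sdiff_subset hv
    rcases h with h0 | hb | ⟨t, ht, j, hj1, hjL, rfl, hruns⟩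
    · rw [h0]; exact mem_openCluster_self _ _
    · rw [hb]; exact hbX
    · by_cases htp : t = p
      · subst htp; exact step2 t a ht haL hPa hPfree j hj1 hjL hruns
      by_cases htq : t = q
      · subst htq; exact step2 t c ht hcL hQc hQfree j hj1 hjL hruns
      exact bundle_prefix_mem_cluster ends r L w e u hw0 harc lam t ht j (le_of_lt hjL)
        fun j' h1 h2 => other_red t ht htp htq j' h1 (by omega)
  -- ## (T3): the blue cluster of the lift lies in the red cluster of the partner
  have step3 : ∀ (t n : ℕ), t < r → n < L t →
      (∀ j, 1 ≤ j → j ≤ n → e t j ∈ ξ ∧ e t j ∈ ρ) →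
      (∀ j, 1 ≤ j → j ≤ L t → (n = 0 ∨ n + 2 ≤ j) → (e t j ∈ ρ ↔ e t j ∉ ξ)) →
      ∀ j, 1 ≤ j → j < L t → (∀ j', 1 ≤ j' → j' ≤ j → e t j' ∈ E \ lam) → w t j ∈ C ρ := by
    intro t n ht hn hpre hfree j hj1 hjL hrun
    by_cases hn0 : n = 0
    · exact bundle_prefix_mem_cluster ends r L w e u hw0 harc ρ t ht j (le_of_lt hjL)
        fun j' h1 h2 => (hfree j' h1 (by omega) (Or.inl hn0)).mpr fun hm => (Finset.mem_sdiff.mp (hrun j' h1 h2)).2 (hξlam hm)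
    · exfalso
      exact (Finset.mem_sdiff.mp (hrun 1 (le_refl 1) hj1)).2 (hξlam (hpre 1 (le_refl 1) (by omega)).1)
  have T3 : C (E \ lam) ⊆ C ρ := by
    intro v hv
    have h := bundle_cluster_subset_prefix ends r L w e u hw0 harc hwinj hcross E hE (E \ lam) Finset.sdiff_subset no_full_compl hv
    rcases h with h0 | ⟨t, ht, j, hj1, hjL, rfl, hrun⟩
    · rw [h0]; exact mem_openCluster_self _ _
    · by_cases htp : t = p
      · subst htp; exact step3 t a ht haL hPa hPfree j hj1 hjL hrun
      by_cases htq : t = q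
      · subst htq; exact step3 t c ht hcL hQc hQfree j hj1 hjL hrun
      exfalso
      exact (Finset.mem_sdiff.mp (hrun 1 (le_refl 1) hj1)).2 (other_red t ht htp htq 1 (le_refl 1) (hL t ht))
  exact ⟨hbX, hbY, T2, T3⟩

open Classical in
/-- **Chain lemma.**  On an explicit bundle let `σ₁, σ₂ ⊆ E` be colourings without a fully red thread such that every thread other than one fixed
thread `o` has its first edge blue in both.  Then `C_u(σ₁) ⊆ C_u(σ₂)` or `C_u(σ₂) ⊆ C_u(σ₁)` (both clusters are `u` plus a leading red run of `o`).
Memo gen 45 §3.9 (b).  [cite: KozmaNitzan2024, Questions 8–9 (§5.5 p. 36) (context)] -/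
theorem bundle_boundary_chain (ends : ι → Sym2 V) (r : ℕ) (L : ℕ → ℕ)
    (w : ℕ → ℕ → V) (e : ℕ → ℕ → ι) (u : V)
    (hw0 : ∀ t, t < r → w t 0 = u)
    (harc : ∀ t, t < r → ∀ j, 1 ≤ j → j ≤ L t → ends (e t j) = s(w t (j - 1), w t j))
    (hwinj : ∀ t, t < r → ∀ i j, i ≤ L t → j ≤ L t → w t i = w t j → i = j)
    (hcross : ∀ t t', t < r → t' < r → t ≠ t' → ∀ i j, i ≤ L t → j ≤ L t' → w t i = w t' j → (i = 0 ∧ j = 0) ∨ (i = L t ∧ j = L t'))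
    (E : Finset ι) (hE : ∀ i, i ∈ E → ∃ t, t < r ∧ ∃ j, 1 ≤ j ∧ j ≤ L t ∧ e t j = i)
    (o : ℕ) (σ₁ σ₂ : Finset ι) (hσ₁ : σ₁ ⊆ E) (hσ₂ : σ₂ ⊆ E)
    (hnf₁ : ∀ t, t < r → ∃ j, 1 ≤ j ∧ j ≤ L t ∧ e t j ∉ σ₁) (hnf₂ : ∀ t, t < r → ∃ j, 1 ≤ j ∧ j ≤ L t ∧ e t j ∉ σ₂)
    (hstart₁ : ∀ t, t < r → t ≠ o → e t 1 ∉ σ₁) (hstart₂ : ∀ t, t < r → t ≠ o → e t 1 ∉ σ₂) :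
    openCluster (ends '' (↑σ₁ : Set ι)) u ⊆ openCluster (ends '' (↑σ₂ : Set ι)) u ∨
      openCluster (ends '' (↑σ₂ : Set ι)) u ⊆ openCluster (ends '' (↑σ₁ : Set ι)) u := by
  -- a cluster vertex outside the other cluster is `w o j` with a red prefix and a witness of non-membership below it
  have key : ∀ σ σ' : Finset ι, σ ⊆ E → (∀ t, t < r → ∃ j, 1 ≤ j ∧ j ≤ L t ∧ e t j ∉ σ) → (∀ t, t < r → t ≠ o → e t 1 ∉ σ) →
      ∀ v, v ∈ openCluster (ends '' (↑σ : Set ι)) u → v ∉ openCluster (ends '' (↑σ' : Set ι)) u →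
      o < r ∧ ∃ j, 1 ≤ j ∧ j < L o ∧ (∀ j', 1 ≤ j' → j' ≤ j → e o j' ∈ σ) ∧ ∃ j₁, 1 ≤ j₁ ∧ j₁ ≤ j ∧ e o j₁ ∉ σ' := by
    intro σ σ' hσ hnf hstart v hv hv'
    have h := bundle_cluster_subset_prefix ends r L w e u hw0 harc hwinj hcross E hE σ hσ hnf hv
    rcases h with h0 | ⟨t, ht, j, hj1, hjL, rfl, hrun⟩
    · exact absurd (h0 ▸ mem_openCluster_self _ _) hv'
    · have hto : t = o := by
        by_contra hto
        exact hstart t ht hto (hrun 1 (le_refl 1) hj1)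
      subst hto
      refine ⟨ht, j, hj1, hjL, hrun, ?_⟩
      by_contra hall
      push Not at hall
      exact hv' (bundle_prefix_mem_cluster ends r L w e u hw0 harc σ' t ht j (le_of_lt hjL) fun j' h1 h2 => hall j' h1 h2)
  by_contra hcon
  rw [not_or, Set.not_subset, Set.not_subset] at hcon
  obtain ⟨⟨v, hv, hv'⟩, ⟨v', hv'₂, hv'₁⟩⟩ := hcon
  obtain ⟨_, j, _, _, hrun, j₁, hj₁1, hj₁j, hj₁⟩ := key σ₁ σ₂ hσ₁ hnf₁ hstart₁ v hv hv'
  obtain ⟨_, j', _, _, hrun', j₂, hj₂1, hj₂j, hj₂⟩ := key σ₂ σ₁ hσ₂ hnf₂ hstart₂ v' hv'₂ hv'₁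
  -- j₁ ≤ j is blue in σ₂ but σ₂ is red up to j', so j' < j₁ ≤ j; symmetrically j < j₂ ≤ j'
  have h1 : j' < j₁ := by
    by_contra h; exact hj₁ (hrun' j₁ hj₁1 (by omega))
  have h2 : j < j₂ := by
    by_contra h; exact hj₂ (hrun j₂ hj₂1 (by omega))
  omega

end Coefficientwise

end Summit.CriticalPhenomena.PercolationContinuityZ3.Theorems
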